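import Mathlib
import HarnessLib
import Summits.HubbardSuperconductivity.HubbardSuperconductivity.Theorems.KLProgrammeKLRegimeCountertermOneVolumeJT
import Summits.HubbardSuperconductivity.HubbardSuperconductivity.Theorems.KLProgrammeKLRegimeCountertermShape
import Summits.HubbardSuperconductivity.HubbardSuperconductivity.Theorems.KLProgrammeKLRegimeSplitBundleV14

/-!
# Route `KLProgramme` — crux K3, GEN 5 (bundle `klPredsV14`, Δ23 / (R-I-min) + E2-DRIVE): the COUNTERTERM child's BODY `CountertermP2 klPredsV14 klWindowC`
# — PROVED before the resplit (seat hubbard-kl-k3c3-p2; technique «fixed point on FrameOK's tube (contraction in the frame norm)»)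

The gen-5 two-leg slot `TwoLegStepV14` (p1's `…SplitBundleV14`: function pieces `klTwoLegPieceFn … K.eval i`, frames `TrigPolyC4v`, history
`histV14 = BetaSplitAtS2 ∧ RenormalisedAtF ∧ EngineBoundsAtV9S`) is consumed by the SMOOTHED wholesale continuation — one Jackson-smoothed Picard step
per scale (`…CountertermJackson*`, `…CountertermContinuationJ(T)`, `…CountertermOneVolumeJ(T)`; the chain is parametric in the history), the EXACT
reading (k3c3-p1 `…CountertermReadingFn`) and the volume transfer `ct_volumeTransfer_of_rate` (verbatim).  Result:

  **`CtJ.countertermP2_klPredsV14 : CountertermP2 klPredsV14 klWindowC`.**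

The gen-5 route closer is the one-liner `theorem KLRegimeCountertermV14_of : …Theses.KLProgramme.KLRegimeCountertermV14 := KLRegimeSplit.CtJ.countertermP2_klPredsV14`,
filed `--workitem` on the gen-5 id at birth.  Reads of `TwoLegStepV14` (audit column (iv)): the `C⁴` conjunct and tier-1 `j ∈ {0,1}` sizes,
`FrameLipschitzFnT histV14`, `TwoLegSizesMSFn` (all of it), `TwoLegVolumeRate` (V14 antecedent), and the structural `RenormalisedAtF n → histV14 K n`;
nothing else.  Proof only; nothing is asserted about the Hubbard model beyond the hypothesis block.
-/

noncomputable section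

namespace Summit.HubbardSuperconductivity.HubbardSuperconductivity.Theorems.KLRegimeSplit

set_option linter.dupNamespace false -- summit = problem name (single-conjunct summit), D-0017

open Real Finset
open Literature.MathematicalPhysics.QuantumLattice Literature.Probability.LatticeModels
open Summit.HubbardSuperconductivity.HubbardSuperconductivity.Theorems.KLProgrammeLegKernels

namespace CtJ

/-- **THE COUNTERTERM CHILD OF K3 AT GEN 5**: `CountertermP2 klPredsV14 klWindowC` — one admissible `TrigPolyC4v` frame, chosen before the
volume, renormalised at every scale at every large volume; by the Jackson-smoothed wholesale continuation on the function pieces (self-map of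
FrameOK's tube with constant one, contraction through `FrameLipschitzFnT`, exact reading, volume transfer by (E3f)). -/
theorem countertermP2_klPredsV14 : CountertermP2 klPredsV14 klWindowC := by
  intro G P hG _
  refine ⟨ctRenMs G, ctRenMs_WF2 hG, fun Q hQ => ?_⟩
  obtain ⟨c₁, hc₁, hc⟩ := ct_oneVolume_thresholdsJT G Q hG hQ
  refine ⟨c₁, hc₁, fun c hc0 hcc => ?_⟩
  obtain ⟨U₀, hU₀, hmain⟩ := hc c hc0 hcc
  refine ⟨U₀, hU₀, fun μ hμ U hU hUle β hβ hβc Lh Mh hhyp => ?_⟩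
  have hCL : ∀ n, 0 ≤ Q.CL β n := fun n => hQ.2.2.2.2.2.2.2 β n
  obtain ⟨L₀, M₀, hL₀pos, hM₀pos, hLh, hMh, hM0, hrate, hvol⟩ :=
    hmain μ hμ U hU hUle β hβ hβc Lh Mh (Q.M0 β) (Q.CL β) hCL
  haveI : NeZero L₀ := ⟨Nat.pos_iff_ne_zero.mp hL₀pos⟩
  haveI : NeZero M₀ := ⟨Nat.pos_iff_ne_zero.mp hM₀pos⟩
  -- the gen-5 block at any volume beyond the thresholds, from the hypothesis block of `CountertermP2` at `klPredsV14`
  have blkAt : ∀ (L M : ℕ) [NeZero L] [NeZero M], Lh ≤ L → Mh L ≤ M →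
      ∀ K : TrigPolyC4v, FrameOK (ctRenMs G) U (nScales β) μ K → ∀ n : ℕ, n ≤ nScales β →
        (∀ j < n, RenormalisedAtF L M β U μ K (ctRenMs G) j) →
          (ContDiff ℝ 4 (onM (klTwoLegPieceFn L M β U μ K.eval n)) ∧
            ∀ j ≤ 2, ∀ q : Momentum, ‖iteratedFDeriv ℝ j (onM (klTwoLegPieceFn L M β U μ K.eval n)) q‖ ≤ twoLegBar G Q U j n) ∧
            FrameLipschitzFnT L M (histV14 L M G P Q (ctRenMs G) β U μ) G Q (ctRenMs G) β U μ K n ∧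
              TwoLegSizesMSFn L M G Q (ctRenMs G) β U μ K.eval n ∧
                (RenormalisedAtF L M β U μ K (ctRenMs G) n → histV14 L M G P Q (ctRenMs G) β U μ K n) := by
    intro L M _ _ hL hM K hK n hn hren
    obtain ⟨hE, hTw, hS⟩ := hhyp K hK L M hL hM n hn hren
    have hT := twoLegCoreT_of_twoLegStepV14 hTw
    exact ⟨hT.1, hT.2.1, twoLegSizesMST_of_twoLegStepV14 hTw, fun hr => ⟨hS, hr, hE⟩⟩
  -- the one-volume construction at `(L₀, M₀)`
  obtain ⟨K, hK, hhalf⟩ := hvol inferInstance inferInstance (histV14 L₀ M₀ G P Q (ctRenMs G) β U μ) (blkAt L₀ M₀ hLh hMh)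
  refine ⟨K, hK, L₀, fun L => max (Mh L) (Q.M0 β L), fun L M _ _ hL hM n hn => ?_⟩
  -- renormalisation at the construction volume, at every scale (half tolerance ≤ tolerance)
  have htol_nonneg : ∀ n, 0 ≤ ctCr G * |U| * klScale klE0 n ^ 2 / klE0 / 2 := by
    intro n
    have hS : ∀ j, 0 ≤ G.S j := hG.2.2.2.2.2.2.2.2.2.2.2.2.2.2.2.2.2.1
    have hcr : 0 ≤ ctCr G := by unfold ctCr; nlinarith [hS 0]
    have he0 : (0 : ℝ) < klE0 := by norm_num [klE0]
    positivity
  have hren0 : ∀ n, n ≤ nScales β → RenormalisedAtF L₀ M₀ β U μ K (ctRenMs G) n := by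
    intro n hn θ
    have h := hhalf n hn θ
    show |klLocalPart L₀ M₀ β U μ K n θ| ≤ ctCr G * |U| * klScale klE0 n ^ 2 / klE0
    linarith [htol_nonneg n]
  -- the rate between the construction volume and any larger volume, from (E3f) at `(L₀, M₀)` and the V14 history at `(L, M)`
  have rate : ∀ (L M : ℕ) [NeZero L] [NeZero M], L₀ ≤ L → max (Mh L) (Q.M0 β L) ≤ M → ∀ n : ℕ, n ≤ nScales β →
      (∀ j < n, RenormalisedAtF L M β U μ K (ctRenMs G) j) →
        ∀ θ : ℝ, |klLocalPart L₀ M₀ β U μ K n θ - klLocalPart L M β U μ K n θ| ≤ Q.CL β n / L₀ := by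
    intro L M _ _ hL hM n hn hrenL θ
    have hMhL : Mh L ≤ M := (le_max_left _ _).trans hM
    have hM0L : Q.M0 β L ≤ M := (le_max_right _ _).trans hM
    obtain ⟨_, hTw, _⟩ := hhyp K hK L₀ M₀ hLh hMh n hn fun j hj => hren0 j (le_of_lt (lt_of_lt_of_le hj hn))
    have hhist : HistP klPredsV14 L M G P Q (ctRenMs G) β U μ K n := by
      intro j hj
      obtain ⟨hE, hTwj, hS⟩ := hhyp K hK L M (hLh.trans hL) hMhL j (le_of_lt (lt_of_lt_of_le hj hn))
        fun i hi => hrenL i (hi.trans hj)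
      exact ⟨hS, hrenL j hj, hE, hTwj⟩
    exact twoLegVolumeRate_apply_of_V14 hTw hM0 hL hM0L hhist θ
  exact ct_volumeTransfer_of_rate (G := G) (R := ctRenMs G) rfl rate (fun n hn => ⟨hhalf n hn, hrate n hn⟩) L M hL hM n hn

end CtJ

end Summit.HubbardSuperconductivity.HubbardSuperconductivity.Theorems.KLRegimeSplit

end
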